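import Mathlib
import HarnessLib
import Summits.AtomisticToContinuum.Crystallization.Theorems.FrustratedLawDichotomyTwoShellRigidityLsFitReplayFit

/-!
# Two-shell rigidity, slot 3 · the `SphericalLsFit` replay engine (5b): the rational interface
# (decomp-a2c, lens 3, gen 37 — NODE «SphericalLsFitReplay»; mechanical split of part (5) for the 400-line rule)

The primed wrappers `sphericalLsFit_fcc_of_checkAllF'` / `sphericalLsFit_hcp_of_checkAllF'`: the side conditions of
part (5) with `√2, √3, √18` replaced by the rational enclosures `1414/1000 ≤ √2 ≤ 14143/10000`, `1732/1000 ≤ √3`,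
`√18 ≤ 42427/10000`, so that on chosen integers `(B2, F0L, OM2, V1K, V3K)` and rationals `(β, α, Ω, V₁, V₃)` every
hypothesis is a `norm_num [SC]` goal; plus one compiled example of the final 15-line assembly shape.
`[folklore]`; no `sorry`; no `instance`/`notation`; no data.
-/

namespace Summit.AtomisticToContinuum.Crystallization.Theorems

namespace Rig

open Literature.Geometry.DiscreteGeometry
open Literature.Analysis.ValidatedNumerics.NumericsMP
open Summit.AtomisticToContinuum.Crystallization.Theorems.FrustratedLawDichotomyTwoShellRigidityLsLedger
open Summit.AtomisticToContinuum.Crystallization.Theorems.FrustratedLawDichotomyTwoShellRigidityCut (E3)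
open Summit.AtomisticToContinuum.Crystallization.Theorems.FrustratedLawDichotomyTwoShellRigidityGaugedLadder
open scoped RealInnerProductSpace

/-! ### Rational interface (the side conditions become `norm_num` goals on the chosen integers) -/

/-- `1414/1000 ≤ √2 ≤ 14143/10000`. -/
theorem sqrt_two_bounds : (1414 / 1000 : ℝ) ≤ Real.sqrt 2 ∧ Real.sqrt 2 ≤ 14143 / 10000 := by
  constructor
  · rw [show (1414 / 1000 : ℝ) = Real.sqrt ((1414 / 1000) ^ 2) by rw [Real.sqrt_sq (by norm_num)]]
    exact Real.sqrt_le_sqrt (by norm_num)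
  · rw [show (14143 / 10000 : ℝ) = Real.sqrt ((14143 / 10000) ^ 2) by rw [Real.sqrt_sq (by norm_num)]]
    exact Real.sqrt_le_sqrt (by norm_num)

/-- `1732/1000 ≤ √3`. -/
theorem sqrt_three_lower : (1732 / 1000 : ℝ) ≤ Real.sqrt 3 := by
  rw [show (1732 / 1000 : ℝ) = Real.sqrt ((1732 / 1000) ^ 2) by rw [Real.sqrt_sq (by norm_num)]]
  exact Real.sqrt_le_sqrt (by norm_num)

/-- `√18 ≤ 42427/10000`. -/
theorem sqrt_eighteen_upper : Real.sqrt 18 ≤ 42427 / 10000 := by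
  rw [show (42427 / 10000 : ℝ) = Real.sqrt ((42427 / 10000) ^ 2) by rw [Real.sqrt_sq (by norm_num)]]
  exact Real.sqrt_le_sqrt (by norm_num)

/-- Rational sufficient conditions for the three probe levels (`c = 8·N·S`). -/
theorem levels_of_rat {L : KLevels} {c V : ℝ} (hV : 0 ≤ V) (hc : 0 ≤ c)
    (h1 : (L.k1 : ℝ) ≤ c * V) (h2 : (L.k2 : ℝ) ≤ c * (1414 / 1000) * V) (h3 : (L.k3 : ℝ) ≤ c * (1732 / 1000) * V) :
    ∀ k, kOK k = true → (L.getK k : ℝ) ≤ c * Real.sqrt k * V := by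
  intro k hk
  unfold kOK at hk
  rw [decide_eq_true_eq] at hk
  rcases hk with rfl | rfl | rfl
  · simp only [KLevels.getK, if_true, Nat.cast_one, Real.sqrt_one, mul_one]; exact h1
  · have hg : L.getK 2 = L.k2 := by simp [KLevels.getK]
    rw [hg]
    refine h2.trans ?_
    push_cast
    have := sqrt_two_bounds.1
    nlinarith [mul_nonneg hc hV]
  · have hg : L.getK 3 = L.k3 := by simp [KLevels.getK]
    rw [hg]
    refine h3.trans ?_
    push_cast
    have := sqrt_three_lower
    nlinarith [mul_nonneg hc hV]

/-- **FCC, rational interface**: with `B2 ≥ β·S²`, `F0L ≥ S·1.4143·(1−α²/2)`, `OM2 ≤ 128·Ω²·S²`,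
`V1K = (k1,k2,k3) ≤ 16·S·(1, 1.414, 1.732)·V₁`, `V3K ≤ 16·S·(1, 1.414, 1.732)·V₃` (all `norm_num` on literals). -/
theorem sphericalLsFit_fcc_of_checkAllF' {prm : FitPrm} {cells : List CellF}
    (hchk : checkAllF fccModel prm cells = true) (hpt : prm.ptab = ptab26)
    {β α Ω V₁ V₃ : ℝ} (hB2 : β * (SC : ℝ) ^ 2 ≤ prm.B2) (hα : 0 ≤ α) (hα2 : α ^ 2 ≤ 2) (hΩ : 0 ≤ Ω)
    (hV₁ : 0 ≤ V₁) (hV₃ : 0 ≤ V₃)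
    (hF0 : (SC : ℝ) * (14143 / 10000) * (1 - α ^ 2 / 2) ≤ prm.F0L)
    (hOM : (prm.OM2 : ℝ) ≤ 128 * Ω ^ 2 * (SC : ℝ) ^ 2)
    (h11 : (prm.V1K.k1 : ℝ) ≤ 16 * SC * V₁) (h12 : (prm.V1K.k2 : ℝ) ≤ 16 * SC * (1414 / 1000) * V₁)
    (h13 : (prm.V1K.k3 : ℝ) ≤ 16 * SC * (1732 / 1000) * V₁)
    (h31 : (prm.V3K.k1 : ℝ) ≤ 16 * SC * V₃) (h32 : (prm.V3K.k2 : ℝ) ≤ 16 * SC * (1414 / 1000) * V₃)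
    (h33 : (prm.V3K.k3 : ℝ) ≤ 16 * SC * (1732 / 1000) * V₃) :
    SphericalLsFit β (1 / 100) fccKissingPattern probes26 α Ω V₁ V₃ := by
  have hS : (0 : ℝ) ≤ (SC : ℝ) := Nat.cast_nonneg _
  refine sphericalLsFit_fcc_of_checkAllF hchk hpt hB2 hα hΩ ?_ ?_ ?_ ?_
  · refine le_trans ?_ hF0
    have h1 : 0 ≤ 1 - α ^ 2 / 2 := by linarith
    exact mul_le_mul_of_nonneg_right (mul_le_mul_of_nonneg_left sqrt_two_bounds.2 hS) h1
  · linarith [hOM]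
  · have h := levels_of_rat hV₁ (by positivity : (0:ℝ) ≤ 16 * SC) h11 h12 h13
    intro k hk; have := h k hk; linarith
  · have h := levels_of_rat hV₃ (by positivity : (0:ℝ) ≤ 16 * SC) h31 h32 h33
    intro k hk; have := h k hk; linarith

/-- **HCP, rational interface**: `F0L ≥ S·4.2427·(1−α²/2)`, `OM2 ≤ 1152·Ω²·S²`, levels `≤ 144·S·(1, 1.414, 1.732)·V`. -/
theorem sphericalLsFit_hcp_of_checkAllF' {prm : FitPrm} {cells : List CellF}
    (hchk : checkAllF hcpModel prm cells = true) (hpt : prm.ptab = ptab26)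
    {β α Ω V₁ V₃ : ℝ} (hB2 : β * (SC : ℝ) ^ 2 ≤ prm.B2) (hα : 0 ≤ α) (hα2 : α ^ 2 ≤ 2) (hΩ : 0 ≤ Ω)
    (hV₁ : 0 ≤ V₁) (hV₃ : 0 ≤ V₃)
    (hF0 : (SC : ℝ) * (42427 / 10000) * (1 - α ^ 2 / 2) ≤ prm.F0L)
    (hOM : (prm.OM2 : ℝ) ≤ 1152 * Ω ^ 2 * (SC : ℝ) ^ 2)
    (h11 : (prm.V1K.k1 : ℝ) ≤ 144 * SC * V₁) (h12 : (prm.V1K.k2 : ℝ) ≤ 144 * SC * (1414 / 1000) * V₁)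
    (h13 : (prm.V1K.k3 : ℝ) ≤ 144 * SC * (1732 / 1000) * V₁)
    (h31 : (prm.V3K.k1 : ℝ) ≤ 144 * SC * V₃) (h32 : (prm.V3K.k2 : ℝ) ≤ 144 * SC * (1414 / 1000) * V₃)
    (h33 : (prm.V3K.k3 : ℝ) ≤ 144 * SC * (1732 / 1000) * V₃) :
    SphericalLsFit β (1 / 100) hcpKissingPattern probes26 α Ω V₁ V₃ := by
  have hS : (0 : ℝ) ≤ (SC : ℝ) := Nat.cast_nonneg _
  refine sphericalLsFit_hcp_of_checkAllF hchk hpt hB2 hα hΩ ?_ ?_ ?_ ?_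
  · refine le_trans ?_ hF0
    have h1 : 0 ≤ 1 - α ^ 2 / 2 := by linarith
    exact mul_le_mul_of_nonneg_right (mul_le_mul_of_nonneg_left sqrt_eighteen_upper hS) h1
  · linarith [hOM]
  · have h := levels_of_rat hV₁ (by positivity : (0:ℝ) ≤ 144 * SC) h11 h12 h13
    intro k hk; have := h k hk; linarith
  · have h := levels_of_rat hV₃ (by positivity : (0:ℝ) ≤ 144 * SC) h31 h32 h33
    intro k hk; have := h k hk; linarith

/-- Example of the shape of the final assembly (illustrative integers; `hchk` is the census `native_decide`). -/
example {cells : List CellF}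
    (hchk : checkAllF fccModel ⟨2 ^ 116, 2 ^ 61, 2 ^ 119, ⟨2 ^ 59, 2 ^ 59, 2 ^ 59⟩, ⟨2 ^ 60, 2 ^ 60, 2 ^ 60⟩, ptab26⟩ cells = true) :
    SphericalLsFit (7 / 200) (1 / 100) fccKissingPattern probes26 (11 / 100) (3 / 40) (1 / 20) (1 / 10) :=
  sphericalLsFit_fcc_of_checkAllF' hchk rfl (by norm_num [SC]) (by norm_num) (by norm_num) (by norm_num) (by norm_num)
    (by norm_num) (by norm_num [SC]) (by norm_num [SC]) (by norm_num [SC]) (by norm_num [SC]) (by norm_num [SC])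
    (by norm_num [SC]) (by norm_num [SC]) (by norm_num [SC])

end Rig

end Summit.AtomisticToContinuum.Crystallization.Theorems
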